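import Summits.AtomisticToContinuum.Crystallization.Theorems.ThreeConeCertificateSlackRigidityHammingEkeland
import Summits.AtomisticToContinuum.Crystallization.Theorems.ThreeConeCertificateSlackRigidityQgsSeparation
import Summits.AtomisticToContinuum.Crystallization.Theorems.ThreeConeCertificateSlackRigidityBadCountTransfer
import HarnessLib

/-!
# Line `ekeland-surgery-parity` (crux `SlackRigidity`, stmt-AtomisticToContinuum-11960): the Hamming–Ekeland regularisation, composed (unconditional)

The planner's first stub of the line, `QuasiRegularisation`, and two reformulations of the crux,
now THEOREMS: they are composed from the three landed regularisation lemmas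
`EkelandHammingEkeland.stub_hammingEkeland` (E1, discrete Ekeland principle in the Hamming metric,
p123674), `EkelandQgsSeparation.stub_qgsSeparation` (E2, `λ ≤ 10⁴` quasi-ground-states are
`1/3`-separated, p123701) and `EkelandBadCountTransfer.stub_badCountTransfer` (E3, bad counts move
by `O(Hamming distance)`, p123659):

* `quasiRegularisation` — along an injective `o(N)`-excess Lennard-Jones sequence `x^N` there is a
  `1/3`-separated sequence of `λ_N`-quasi-ground-states `x'^N` (no relocation of `k` particles
  lowers the energy by more than `k·λ_N`), `λ_N → 0`, with `𝓔(x'^N) ≤ 𝓔(x^N)` and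
  `badCount(x^N) ≤ badCount(x'^N) + err_N`, `err_N/N → 0`.  Rate: `λ_N = min(10⁴, √t_N + 1/(N+1))`,
  `t_N` the excess per particle, so that `λ_N → 0` and `t_N/λ_N ≤ t_N/10⁴ + √t_N → 0`.
* `slackRigidity_iff_qgsRigidity` — the crux is EQUIVALENT to the same matching statement for
  sequences of `λ_N`-quasi-ground-states with `λ_N → 0` (at `λ_N ≡ 0` that right-hand side is the
  hinge `BulkDefectVanish`, item 0751, verbatim: `0`-quasi-ground-states are the ground states) —
  this isolates exactly what separates crux 11960 from hinge 0751: `λ_N → 0` versus `λ_N = 0`.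
* `slackRigidity_iff_separated` — the crux is EQUIVALENT to its restriction to uniformly
  `1/3`-separated injective sequences (the WLOG that every line of this crux paid for separately).

All `[folklore]` (Ekeland 1974 in the discrete complete metric given by the Hamming distance;
separation as in the tree's `LennardJonesMinimalDistance_holds`).
-/

noncomputable section

namespace Summit.AtomisticToContinuum.Crystallization.Theorems.EkelandQuasiRegularisation

open scoped BigOperators Topology
open Filter
open Literature.MathematicalPhysics.StatisticalMechanics
open Summit.AtomisticToContinuum.Crystallization.Theses.ThreeConeCertificate (SlackRigidity)
open Summit.AtomisticToContinuum.Crystallization.Theorems.SlackRigidityNegative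
  (E3 Good badCount BadFractionVanishes ExcessVanishes)
open Summit.AtomisticToContinuum.Crystallization.Theorems.EkelandHammingEkeland (stub_hammingEkeland)
open Summit.AtomisticToContinuum.Crystallization.Theorems.EkelandQgsSeparation (stub_qgsSeparation)
open Summit.AtomisticToContinuum.Crystallization.Theorems.EkelandBadCountTransfer
  (stub_badCountTransfer)

/-- Excess energies of injective configurations are non-negative. [folklore] -/
theorem excess_nonneg {N : ℕ} {x : Fin N → E3} (hx : Function.Injective x) :
    0 ≤ interactionEnergy lennardJones x - groundStateEnergy lennardJones 3 N :=
  sub_nonneg.2 (groundStateEnergy_lennardJones_le hx)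

/-- A `λ`-quasi-ground-state (`λ ≥ 0`) has excess at most `λ N`. [folklore] -/
theorem excess_le_of_qgs {N : ℕ} {lam : ℝ} (hlam : 0 ≤ lam) {x : Fin N → E3}
    (hx : Function.Injective x)
    (hq : ∀ y : Fin N → E3, Function.Injective y →
      interactionEnergy lennardJones x -
          lam * ((Finset.univ.filter fun i => y i ≠ x i).card : ℝ) ≤
        interactionEnergy lennardJones y) :
    interactionEnergy lennardJones x - groundStateEnergy lennardJones 3 N ≤ lam * N := by
  have hle : ∀ y : {y : Fin N → E3 // Function.Injective y},
      interactionEnergy lennardJones x - lam * N ≤ interactionEnergy lennardJones y.1 := by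
    intro y
    have h := hq y.1 y.2
    have hcard : ((Finset.univ.filter fun i => y.1 i ≠ x i).card : ℝ) ≤ N := by
      have : (Finset.univ.filter fun i => y.1 i ≠ x i).card ≤ N :=
        (Finset.card_filter_le _ _).trans (by simp)
      exact_mod_cast this
    nlinarith [mul_le_mul_of_nonneg_left hcard hlam]
  haveI : Nonempty {y : Fin N → E3 // Function.Injective y} := ⟨⟨x, hx⟩⟩
  have : interactionEnergy lennardJones x - lam * N ≤ groundStateEnergy lennardJones 3 N :=
    le_ciInf hle
  linarith

/-- **The planner's `QuasiRegularisation` (stub 1 of the original skeleton of this line), now a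
consequence of E1–E3**: along an injective `o(N)`-excess sequence there is a `1/3`-separated sequence
of `λ_N`-quasi-ground-states, `λ_N → 0`, with no larger energies and
`badCount(x^N) ≤ badCount(x'^N) + err_N`, `err_N / N → 0`. [folklore] -/
theorem quasiRegularisation :
    ∀ (P : PeriodicConfiguration 3) (R ε : ℝ), 0 < R → 0 < ε →
    ∀ x : (N : ℕ) → (Fin N → E3), (∀ N, Function.Injective (x N)) →
      Tendsto (fun N : ℕ => (interactionEnergy lennardJones (x N) -
        groundStateEnergy lennardJones 3 N) / N) atTop (𝓝 0) →
      ∃ (x' : (N : ℕ) → (Fin N → E3)) (lam : ℕ → ℝ) (err : ℕ → ℝ),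
        (∀ N, 0 ≤ lam N) ∧ Tendsto lam atTop (𝓝 0) ∧
        (∀ N, Function.Injective (x' N) ∧ ∀ y : Fin N → E3, Function.Injective y →
          interactionEnergy lennardJones (x' N) -
              lam N * ((Finset.univ.filter fun i => y i ≠ x' N i).card : ℝ) ≤
            interactionEnergy lennardJones y) ∧
        (∀ N (i j : Fin N), i ≠ j → (1 / 3 : ℝ) ≤ dist (x' N i) (x' N j)) ∧
        (∀ N, interactionEnergy lennardJones (x' N) ≤ interactionEnergy lennardJones (x N)) ∧
        Tendsto (fun N : ℕ => err N / N) atTop (𝓝 0) ∧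
        (∀ N, (badCount P R ε (x N) : ℝ) ≤ badCount P R ε (x' N) + err N) := by
  intro P R ε hR hε x hx hex
  -- the excess per particle `t N ≥ 0`, `t N → 0`
  set t : ℕ → ℝ := fun N => (interactionEnergy lennardJones (x N) -
    groundStateEnergy lennardJones 3 N) / N with ht
  have ht0 : ∀ N, 0 ≤ t N := fun N => div_nonneg (excess_nonneg (hx N)) (Nat.cast_nonneg N)
  have htlim : Tendsto t atTop (𝓝 0) := hex
  -- the rate `λ_N = min(10⁴, √(t N) + 1/(N+1)) > 0`, `λ_N → 0`
  set lam : ℕ → ℝ := fun N => min (10 ^ 4) (Real.sqrt (t N) + 1 / ((N : ℝ) + 1)) with hlam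
  have hlam_pos : ∀ N, 0 < lam N := fun N => by
    refine lt_min (by norm_num) ?_
    have h1 : (0 : ℝ) < 1 / ((N : ℝ) + 1) := by positivity
    linarith [Real.sqrt_nonneg (t N)]
  have hlam_le : ∀ N, lam N ≤ 10 ^ 4 := fun N => min_le_left _ _
  have hs_lim : Tendsto (fun N : ℕ => Real.sqrt (t N) + 1 / ((N : ℝ) + 1)) atTop (𝓝 0) := by
    have h1 : Tendsto (fun N : ℕ => Real.sqrt (t N)) atTop (𝓝 0) := by
      have := (Real.continuous_sqrt.tendsto 0).comp htlim
      rw [Real.sqrt_zero] at this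
      exact this
    have h2 : Tendsto (fun N : ℕ => 1 / ((N : ℝ) + 1)) atTop (𝓝 0) :=
      tendsto_one_div_add_atTop_nhds_zero_nat
    simpa using h1.add h2
  have hlam_lim : Tendsto lam atTop (𝓝 0) :=
    tendsto_of_tendsto_of_tendsto_of_le_of_le tendsto_const_nhds hs_lim
      (fun N => (hlam_pos N).le) (fun N => min_le_right _ _)
  -- E1: regularise each `x N`
  choose x' hx'inj hx'q hx'E hx'ham using
    fun N => stub_hammingEkeland N (lam N) (hlam_pos N) (x N) (hx N)
  -- E2: the regularised configurations are `1/3`-separated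
  have hsep : ∀ N (i j : Fin N), i ≠ j → (1 / 3 : ℝ) ≤ dist (x' N i) (x' N j) :=
    fun N => stub_qgsSeparation N (lam N) (hlam_le N) (x' N) (hx'inj N) (hx'q N)
  -- E3: bad-count transfer constant for `δ = 1/3`
  obtain ⟨C, hC0, hC⟩ := stub_badCountTransfer P R ε (1 / 3) hR hε (by norm_num)
  set err : ℕ → ℝ := fun N => C * ((Finset.univ.filter fun i => x' N i ≠ x N i).card : ℝ)
    with herr
  refine ⟨x', lam, err, fun N => (hlam_pos N).le, hlam_lim, fun N => ⟨hx'inj N, hx'q N⟩, hsep,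
    hx'E, ?_, fun N => hC N (x N) (x' N) (hsep N)⟩
  -- `err N / N → 0`: Hamming distance `≤ (𝓔(x N) − E(N))/λ_N`, and `t N / λ_N ≤ t N/10⁴ + √(t N)`
  have hham : ∀ N, ((Finset.univ.filter fun i => x' N i ≠ x N i).card : ℝ) ≤
      (interactionEnergy lennardJones (x N) - groundStateEnergy lennardJones 3 N) / lam N := by
    intro N
    rw [le_div_iff₀ (hlam_pos N), mul_comm]
    exact (hx'ham N).trans (by linarith [groundStateEnergy_lennardJones_le (d := 3) (hx'inj N)])
  have hbound : ∀ N, err N / N ≤ C * (t N / 10 ^ 4 + Real.sqrt (t N)) := by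
    intro N
    rcases Nat.eq_zero_or_pos N with hN | hN
    · subst hN
      simp only [Nat.cast_zero, div_zero]
      exact mul_nonneg hC0 (add_nonneg (div_nonneg (ht0 0) (by norm_num)) (Real.sqrt_nonneg _))
    have hNpos : (0 : ℝ) < N := by exact_mod_cast hN
    have hkey : t N / lam N ≤ t N / 10 ^ 4 + Real.sqrt (t N) := by
      rcases le_total (10 ^ 4 : ℝ) (Real.sqrt (t N) + 1 / ((N : ℝ) + 1)) with hcase | hcase
      · have : lam N = 10 ^ 4 := by rw [hlam]; exact min_eq_left hcase
        rw [this]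
        linarith [Real.sqrt_nonneg (t N)]
      · have hl : lam N = Real.sqrt (t N) + 1 / ((N : ℝ) + 1) := by
          rw [hlam]; exact min_eq_right hcase
        rw [hl]
        have hspos : 0 < Real.sqrt (t N) + 1 / ((N : ℝ) + 1) := hl ▸ hlam_pos N
        rw [div_le_iff₀ hspos]
        have hsq : Real.sqrt (t N) * Real.sqrt (t N) = t N := Real.mul_self_sqrt (ht0 N)
        have h1 : 0 ≤ 1 / ((N : ℝ) + 1) := by positivity
        nlinarith [Real.sqrt_nonneg (t N), div_nonneg (ht0 N) (by norm_num : (0:ℝ) ≤ 10 ^ 4),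
          mul_nonneg (div_nonneg (ht0 N) (by norm_num : (0:ℝ) ≤ 10 ^ 4)) hspos.le,
          mul_nonneg (Real.sqrt_nonneg (t N)) h1]
    have h1 : err N / N = C * (((Finset.univ.filter fun i => x' N i ≠ x N i).card : ℝ) / N) := by
      rw [herr]; ring
    rw [h1]
    refine mul_le_mul_of_nonneg_left ?_ hC0
    calc ((Finset.univ.filter fun i => x' N i ≠ x N i).card : ℝ) / N
        ≤ ((interactionEnergy lennardJones (x N) - groundStateEnergy lennardJones 3 N) / lam N) / N :=
          div_le_div_of_nonneg_right (hham N) hNpos.le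
      _ = t N / lam N := by rw [ht]; field_simp
      _ ≤ _ := hkey
  have hlim0 : Tendsto (fun N => C * (t N / 10 ^ 4 + Real.sqrt (t N))) atTop (𝓝 0) := by
    have h1 : Tendsto (fun N : ℕ => Real.sqrt (t N)) atTop (𝓝 0) := by
      have := (Real.continuous_sqrt.tendsto 0).comp htlim
      rw [Real.sqrt_zero] at this
      exact this
    have h2 : Tendsto (fun N => t N / 10 ^ 4) atTop (𝓝 0) := by
      simpa using htlim.div_const (10 ^ 4 : ℝ)
    simpa using (h2.add h1).const_mul C
  refine tendsto_of_tendsto_of_tendsto_of_le_of_le tendsto_const_nhds hlim0 (fun N => ?_) hbound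
  exact div_nonneg (mul_nonneg hC0 (Nat.cast_nonneg _)) (Nat.cast_nonneg _)

/-- **The crux ⟺ quasi-ground-state rigidity.** `SlackRigidity` is equivalent to the same
statement with the `o(N)`-excess hypothesis replaced by `λ_N`-quasi-minimality with `λ_N → 0`
(`λ_N ≥ 0`); at `λ_N ≡ 0` the right-hand side is the hinge `BulkDefectVanish` (item 0751)
verbatim (`isQuasiGroundState_zero_iff`-type readback: `0`-quasi-ground-states are the ground
states). [folklore] -/
theorem slackRigidity_iff_qgsRigidity :
    SlackRigidity ↔
      ∃ P : PeriodicConfiguration 3, ∀ R ε : ℝ, 0 < R → 0 < ε →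
        ∀ (lam : ℕ → ℝ) (x : (N : ℕ) → (Fin N → E3)), (∀ N, 0 ≤ lam N) →
          (∀ N, Function.Injective (x N) ∧ ∀ y : Fin N → E3, Function.Injective y →
            interactionEnergy lennardJones (x N) -
                lam N * ((Finset.univ.filter fun i => y i ≠ x N i).card : ℝ) ≤
              interactionEnergy lennardJones y) →
          Tendsto lam atTop (𝓝 0) →
          Tendsto (fun N : ℕ => (badCount P R ε (x N) : ℝ) / N) atTop (𝓝 0) := by
  constructor
  · rintro ⟨P, hP⟩
    refine ⟨P, fun R ε hR hε lam x hlam hq hlim => ?_⟩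
    refine hP R ε hR hε x (fun N => (hq N).1) ?_
    -- excess `≤ λ_N N`, so excess per particle `→ 0`
    refine tendsto_of_tendsto_of_tendsto_of_le_of_le tendsto_const_nhds hlim
      (fun N => div_nonneg (excess_nonneg (hq N).1) (Nat.cast_nonneg N)) (fun N => ?_)
    rcases Nat.eq_zero_or_pos N with hN | hN
    · subst hN; simp [hlam 0]
    have hNpos : (0 : ℝ) < N := by exact_mod_cast hN
    rw [div_le_iff₀ hNpos]
    exact excess_le_of_qgs (hlam N) (hq N).1 (hq N).2
  · rintro ⟨P, hP⟩
    refine ⟨P, fun R ε hR hε x hx hex => ?_⟩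
    obtain ⟨x', lam, err, hlam0, hlam, hq, -, -, herr, hbad⟩ :=
      quasiRegularisation P R ε hR hε x hx hex
    have h' := hP R ε hR hε lam x' hlam0 hq hlam
    have hup : Tendsto (fun N : ℕ => (badCount P R ε (x' N) : ℝ) / N + err N / N) atTop (𝓝 0) := by
      simpa using h'.add herr
    refine tendsto_of_tendsto_of_tendsto_of_le_of_le tendsto_const_nhds hup
      (fun N => by positivity) (fun N => ?_)
    show (badCount P R ε (x N) : ℝ) / N ≤ (badCount P R ε (x' N) : ℝ) / N + err N / N
    rw [← add_div]
    exact div_le_div_of_nonneg_right (hbad N) (Nat.cast_nonneg N)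

/-- **The crux ⟺ the crux on uniformly separated sequences.** In `SlackRigidity` one may assume
the near-minimisers `1/3`-separated (same `N`, same particles up to `o(N)` relocations). [folklore] -/
theorem slackRigidity_iff_separated :
    SlackRigidity ↔
      ∃ P : PeriodicConfiguration 3, ∀ R ε : ℝ, 0 < R → 0 < ε →
        ∀ x : (N : ℕ) → (Fin N → E3), (∀ N, Function.Injective (x N)) →
          (∀ N (i j : Fin N), i ≠ j → (1 / 3 : ℝ) ≤ dist (x N i) (x N j)) →
          ExcessVanishes x → BadFractionVanishes P R ε x := by
  constructor
  · rintro ⟨P, hP⟩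
    exact ⟨P, fun R ε hR hε x hx _ hex => hP R ε hR hε x hx hex⟩
  · rintro ⟨P, hP⟩
    refine ⟨P, fun R ε hR hε x hx hex => ?_⟩
    obtain ⟨x', lam, err, -, -, hq, hsep, hE, herr, hbad⟩ :=
      quasiRegularisation P R ε hR hε x hx hex
    have hex' : ExcessVanishes x' := by
      refine tendsto_of_tendsto_of_tendsto_of_le_of_le tendsto_const_nhds hex
        (fun N => div_nonneg (excess_nonneg (hq N).1) (Nat.cast_nonneg N)) (fun N => ?_)
      exact div_le_div_of_nonneg_right (by linarith [hE N]) (Nat.cast_nonneg N)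
    have h' := hP R ε hR hε x' (fun N => (hq N).1) hsep hex'
    have hup : Tendsto (fun N : ℕ => (badCount P R ε (x' N) : ℝ) / N + err N / N) atTop (𝓝 0) := by
      simpa using h'.add herr
    refine tendsto_of_tendsto_of_tendsto_of_le_of_le tendsto_const_nhds hup
      (fun N => by positivity) (fun N => ?_)
    show (badCount P R ε (x N) : ℝ) / N ≤ (badCount P R ε (x' N) : ℝ) / N + err N / N
    rw [← add_div]
    exact div_le_div_of_nonneg_right (hbad N) (Nat.cast_nonneg N)

end Summit.AtomisticToContinuum.Crystallization.Theorems.EkelandQuasiRegularisation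

end
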